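import Literature.Analysis.SpecialFunctions.BesselKHalfIntegral
import Literature.NumberTheory.LFunctions.GaussianThetaSeries
import Mathlib.Analysis.SpecialFunctions.Trigonometric.Cotangent
import HarnessLib

/-!
# `∫₀^∞ oddKernel(a, u) e^{−πy²u} du = Re cot π(a + iy)`: the theta side of the value at `s = 1`

Topic `Literature/NumberTheory/LFunctions`, continuing `GaussianThetaSeries` (weight-one theta
series of `ℤ[i]` built from Mathlib's Hurwitz kernels `oddKernel a u = Σ_m (m + a) e^{−π(m+a)²u}`,
`evenKernel b u = Σ_m e^{−π(m+b)²u}`). Everything here is proved; there are no new definitions.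

The class theta functions of `GaussianThetaSeries` are `M (oddKernel · evenKernel + i evenKernel ·
oddKernel)(Mt)`, so the value at `s = 1` of the `L`-series of such a theta series — the number
Birch and Swinnerton-Dyer need in *Notes on elliptic curves. II* (Crelle 218 (1965), §3,
(3.4)–(3.5): `L_D(1)` as a finite sum of values of "`ξ`, the Weierstrass zeta-function with periods
`1, i`") — is governed by the integrals

  `J(a, y) = ∫₀^∞ oddKernel(a, u) e^{−πy²u} du`   (`I(a, b) = Σ_m J(a, m + b)` collects a class).

We prove (`integral_oddKernel_mul_exp_eq_re_cot`):

  **`J(a, y) = Re cot π(a + iy)`** for every real `y ≠ 0`, and for `y = 0` when `a ∉ ℤ`.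

For `y > 0`: one theta inversion `oddKernel(a, u) = u^{-3/2} sinKernel(a, 1/u)`,
`sinKernel(a, v) = Σ_{n≥1} 2n sin(2πna) e^{−πn²v}` (Mathlib), then termwise integration (absolutely
justified) with the `K_{1/2}` integral `∫₀^∞ u^{-3/2} e^{−πn²/u − πy²u} du = n⁻¹ e^{−2πny}`
(`Literature.Analysis.SpecialFunctions.BesselKHalf`) gives
`J(a, y) = Σ_{n≥1} 2 sin(2πna) e^{−2πny}`, which is the real part of the `q`-expansion
`cot πz = −i(1 + 2Σ_{n≥1} e^{2πinz})` at `z = a + iy` (Mathlib's `pi_mul_cot_pi_q_exp`). The case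
`y < 0` follows by conjugation, and `y = 0`, `a ∉ ℤ` by letting `y → 0⁺` (dominated convergence on
the left, continuity of `cot` at `πa` on the right) — so no special value of the Hurwitz zeta
function is needed for the conditionally convergent `Σ_m (m + a)⁻¹ = π cot πa`.

Also recorded: decay and integrability of `oddKernel`, `evenKernel` and their product on `(0, ∞)`
(`integrableOn_oddKernel`, `integrableOn_oddKernel_mul_evenKernel`), used by the companion
`GaussianThetaClassIntegral.lean` to sum `J(a, m + b)` over `m`.

## References

* B. J. Birch, H. P. F. Swinnerton-Dyer, *Notes on elliptic curves. II*, J. reine angew. Math.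
  218 (1965) 79–108, §3.
* E. Hecke, *Mathematische Werke*, no. 14 (1920), §9; A. Weil, *Elliptic functions according to
  Eisenstein and Kronecker* (1976), Ch. III (the cotangent as the basic Eisenstein sum).
-/

noncomputable section

open Complex Real Set Filter Topology Asymptotics MeasureTheory HurwitzZeta

namespace Literature.NumberTheory.LFunctions

namespace GaussianTheta

/-! ### Decay and integrability of the kernels on `(0, ∞)` -/

/-- `oddKernel a = O(t^{-b})` at `0⁺` for every `b` (theta inversion: it is
`t^{-3/2} sinKernel(a, 1/t)` with `sinKernel` exponentially small at `∞`). [folklore] -/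
theorem isBigO_nhdsGT_oddKernel (a : UnitAddCircle) (b : ℝ) :
    (fun t : ℝ ↦ (oddKernel a t : ℂ)) =O[𝓝[>] 0] fun t : ℝ ↦ t ^ (-b) := by
  obtain ⟨p, hp, hg⟩ := isBigO_atTop_sinKernel a
  have hg' : (fun u : ℝ ↦ (sinKernel a u : ℂ)) =O[atTop] fun u ↦ rexp (-p * u) :=
    Complex.isBigO_ofReal_left.mpr hg
  have h := isBigO_nhdsGT_zero_of_isBigO_atTop hp hg' one_pos (3 / 2) b
  refine h.congr' ?_ EventuallyEq.rfl
  filter_upwards [self_mem_nhdsWithin] with t (ht : 0 < t)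
  rw [oddKernel_functional_equation, one_mul, one_div (t ^ (3 / 2 : ℝ)), ← Real.rpow_neg ht.le]
  push_cast
  ring

/-- `oddKernel a = O(e^{-pt})` at `∞` (Mathlib), complex-valued form. [folklore] -/
theorem isBigO_atTop_oddKernel' (a : UnitAddCircle) :
    ∃ p, 0 < p ∧ (fun t : ℝ ↦ (oddKernel a t : ℂ)) =O[atTop] fun t ↦ rexp (-p * t) := by
  obtain ⟨p, hp, h⟩ := isBigO_atTop_oddKernel a
  exact ⟨p, hp, Complex.isBigO_ofReal_left.mpr h⟩

/-- `evenKernel b = O(1)` at `∞`. [folklore] -/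
theorem isBigO_atTop_evenKernel_one (b : UnitAddCircle) :
    (fun t : ℝ ↦ (evenKernel b t : ℂ)) =O[atTop] fun _ : ℝ ↦ (1 : ℝ) := by
  obtain ⟨p, hp, h⟩ := isBigO_atTop_evenKernel_sub b
  rw [Complex.isBigO_ofReal_left]
  have h1 : (fun x ↦ evenKernel b x - if b = 0 then 1 else 0) =O[atTop] fun _ ↦ (1 : ℝ) := by
    refine h.trans (IsBigO.of_bound 1 ?_)
    filter_upwards [eventually_ge_atTop 0] with u hu
    rw [Real.norm_eq_abs, abs_of_pos (Real.exp_pos _), norm_one, one_mul, Real.exp_le_one_iff]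
    nlinarith
  simpa using h1.add (isBigO_const_const (if b = 0 then (1 : ℝ) else 0) one_ne_zero atTop)

/-- `evenKernel b = O(t^{-1/2})` at `0⁺` (theta inversion: it is `t^{-1/2} cosKernel(b, 1/t)` with
`cosKernel` bounded at `∞`). [folklore] -/
theorem isBigO_nhdsGT_evenKernel (b : UnitAddCircle) :
    (fun t : ℝ ↦ (evenKernel b t : ℂ)) =O[𝓝[>] 0] fun t : ℝ ↦ t ^ (-(1 / 2 : ℝ)) := by
  have hC := isBigO_atTop_cosKernel_one b
  have hφ : Tendsto (fun t : ℝ ↦ 1 / t) (𝓝[>] 0) atTop := by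
    simpa only [one_div] using tendsto_inv_nhdsGT_zero
  have h2 := hC.comp_tendsto hφ
  have h0 : (fun t : ℝ ↦ ((t ^ (-(1 / 2 : ℝ)) : ℝ) : ℂ)) =O[𝓝[>] 0]
      fun t : ℝ ↦ t ^ (-(1 / 2 : ℝ)) :=
    Complex.isBigO_ofReal_left.mpr (isBigO_refl _ _)
  have h3 := h0.mul h2
  simp only [Function.comp_def, mul_one] at h3
  refine h3.congr' ?_ EventuallyEq.rfl
  filter_upwards [self_mem_nhdsWithin] with t (ht : 0 < t)
  rw [evenKernel_functional_equation, one_div (t ^ (1 / 2 : ℝ)), ← Real.rpow_neg ht.le]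
  push_cast
  ring

/-- `evenKernel b u ≥ 0`. [folklore] -/
theorem evenKernel_nonneg (b : UnitAddCircle) (u : ℝ) : 0 ≤ evenKernel b u := by
  rcases le_or_gt u 0 with hu | hu
  · rw [evenKernel_undef b hu]
  · induction b using QuotientAddGroup.induction_on with
    | H b' => exact (hasSum_int_evenKernel b' hu).nonneg fun n ↦ (Real.exp_pos _).le

/-- **`oddKernel a · evenKernel b` is integrable on `(0, ∞)`**: continuous, `O(t^{1/2})` at `0⁺`
and exponentially small at `∞`. [folklore] -/
theorem integrableOn_oddKernel_mul_evenKernel (a b : UnitAddCircle) :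
    IntegrableOn (fun u : ℝ ↦ oddKernel a u * evenKernel b u) (Ioi 0) := by
  set F : ℝ → ℂ := fun u ↦ ((oddKernel a u * evenKernel b u : ℝ) : ℂ) with hF
  have hcont : ContinuousOn F (Ioi 0) :=
    continuous_ofReal.comp_continuousOn ((continuousOn_oddKernel a).mul (continuousOn_evenKernel b))
  have htop : F =O[atTop] fun t : ℝ ↦ t ^ (-(2 : ℝ)) := by
    obtain ⟨p, hp, hO⟩ := isBigO_atTop_oddKernel' a
    have h := hO.mul (isBigO_atTop_evenKernel_one b)
    simp only [mul_one] at h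
    have h' : F =O[atTop] fun t ↦ rexp (-p * t) := by
      refine h.congr_left fun t ↦ ?_
      simp [F]
    exact h'.trans (isLittleO_exp_neg_mul_rpow_atTop hp _).isBigO
  have hbot : F =O[𝓝[>] 0] fun t : ℝ ↦ t ^ (-(-(1 / 2) : ℝ)) := by
    have h := (isBigO_nhdsGT_oddKernel a (-1)).mul (isBigO_nhdsGT_evenKernel b)
    have h' : F =O[𝓝[>] 0] fun t : ℝ ↦ t ^ (-(-1 : ℝ)) * t ^ (-(1 / 2 : ℝ)) := by
      refine h.congr_left fun t ↦ ?_
      simp [F]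
    refine h'.trans ?_
    refine (EventuallyEq.isBigO ?_)
    filter_upwards [self_mem_nhdsWithin] with t (ht : 0 < t)
    rw [← Real.rpow_add ht]
    norm_num
  have hM : MellinConvergent F 1 :=
    mellinConvergent_of_isBigO_rpow (hcont.locallyIntegrableOn measurableSet_Ioi) htop
      (by norm_num) hbot (by norm_num)
  have hint : IntegrableOn F (Ioi 0) := by
    refine IntegrableOn.congr_fun hM (fun t _ ↦ ?_) measurableSet_Ioi
    simp only [sub_self, Complex.cpow_zero, one_smul]
  have hre : IntegrableOn (fun x ↦ RCLike.re (F x)) (Ioi 0) := hint.re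
  refine hre.congr_fun (fun t _ ↦ ?_) measurableSet_Ioi
  simp [F]

/-- `‖oddKernel a‖ · evenKernel b` is integrable on `(0, ∞)`. [folklore] -/
theorem integrableOn_norm_oddKernel_mul_evenKernel (a b : UnitAddCircle) :
    IntegrableOn (fun u : ℝ ↦ ‖oddKernel a u‖ * evenKernel b u) (Ioi 0) := by
  have h : IntegrableOn (fun u : ℝ ↦ ‖oddKernel a u * evenKernel b u‖) (Ioi 0) :=
    (integrableOn_oddKernel_mul_evenKernel a b).norm
  refine h.congr_fun (fun u _ ↦ ?_) measurableSet_Ioi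
  simp only [norm_mul, Real.norm_of_nonneg (evenKernel_nonneg b u)]

/-- **`oddKernel a` is integrable on `(0, ∞)`.** [folklore] -/
theorem integrableOn_oddKernel (a : UnitAddCircle) : IntegrableOn (oddKernel a) (Ioi 0) := by
  set F : ℝ → ℂ := fun u ↦ ((oddKernel a u : ℝ) : ℂ) with hF
  have hcont : ContinuousOn F (Ioi 0) :=
    continuous_ofReal.comp_continuousOn (continuousOn_oddKernel a)
  have htop : F =O[atTop] fun t : ℝ ↦ t ^ (-(2 : ℝ)) := by
    obtain ⟨p, hp, hO⟩ := isBigO_atTop_oddKernel' a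
    exact hO.trans (isLittleO_exp_neg_mul_rpow_atTop hp _).isBigO
  have hM : MellinConvergent F 1 :=
    mellinConvergent_of_isBigO_rpow (hcont.locallyIntegrableOn measurableSet_Ioi) htop
      (by norm_num) (isBigO_nhdsGT_oddKernel a 0) (by norm_num)
  have hint : IntegrableOn F (Ioi 0) := by
    refine IntegrableOn.congr_fun hM (fun t _ ↦ ?_) measurableSet_Ioi
    simp only [sub_self, Complex.cpow_zero, one_smul]
  have hre : IntegrableOn (fun x ↦ RCLike.re (F x)) (Ioi 0) := hint.re
  refine hre.congr_fun (fun t _ ↦ ?_) measurableSet_Ioi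
  simp [F]

/-! ### `y > 0`: `∫₀^∞ oddKernel(a, u) e^{−πy²u} du = Σ_{n≥1} 2 sin(2πna) e^{−2πny}` -/

/-- The `n`-th term after theta inversion: `2n sin(2πna) · u^{-3/2} e^{−πn²/u} e^{−πy²u}`, and its
integral `2 sin(2πna) e^{−2πny}` (`K_{1/2}`). [folklore] -/
theorem integral_term_eq (a : ℝ) {y : ℝ} (hy : 0 < y) {n : ℕ} (hn : 0 < n) :
    IntegrableOn (fun u : ℝ ↦ 2 * n * Real.sin (2 * π * a * n) *
        (1 / u ^ (3 / 2 : ℝ) * (rexp (-(π * n ^ 2) * (1 / u)) * rexp (-(π * y ^ 2) * u))))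
        (Ioi 0) ∧
      ∫ u in Ioi (0 : ℝ), 2 * n * Real.sin (2 * π * a * n) *
        (1 / u ^ (3 / 2 : ℝ) * (rexp (-(π * n ^ 2) * (1 / u)) * rexp (-(π * y ^ 2) * u))) =
        2 * Real.sin (2 * π * a * n) * rexp (-(2 * π * n * y)) := by
  have hn' : (0 : ℝ) < n := by exact_mod_cast hn
  have hα : 0 < π * y ^ 2 := by positivity
  have hβ : 0 < π * (n : ℝ) ^ 2 := by positivity
  obtain ⟨hint, hval⟩ :=
    Literature.Analysis.SpecialFunctions.BesselKHalf.integral_one_div_rpow_mul_exp_neg_div_add_mul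
      hα hβ
  refine ⟨hint.const_mul _, ?_⟩
  rw [integral_const_mul, hval]
  have h1 : Real.sqrt (π / (π * (n : ℝ) ^ 2)) = 1 / n := by
    rw [show π / (π * (n : ℝ) ^ 2) = (1 / n) ^ 2 by field_simp, Real.sqrt_sq (by positivity)]
  have h2 : Real.sqrt (π * y ^ 2 * (π * (n : ℝ) ^ 2)) = π * n * y := by
    rw [show π * y ^ 2 * (π * (n : ℝ) ^ 2) = (π * n * y) ^ 2 by ring, Real.sqrt_sq (by positivity)]
  rw [h1, h2]
  field_simp

/-- **For `y > 0`: `∫₀^∞ oddKernel(a, u) e^{−πy²u} du = Σ_n 2 sin(2πna) e^{−2πny}`** (theta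
inversion in the kernel, then termwise integration by the `K_{1/2}` integral; the interchange is
absolutely justified since `Σ_n ∫ |term_n| ≤ Σ_n 2e^{−2πny} < ∞`). [folklore] -/
theorem hasSum_integral_oddKernel_mul_exp (a : ℝ) {y : ℝ} (hy : 0 < y) :
    HasSum (fun n : ℕ ↦ 2 * Real.sin (2 * π * a * n) * rexp (-(2 * π * n * y)))
      (∫ u in Ioi (0 : ℝ), oddKernel a u * rexp (-(π * y ^ 2) * u)) := by
  -- the terms
  set F : ℕ → ℝ → ℝ := fun n u ↦ 2 * n * Real.sin (2 * π * a * n) *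
    (1 / u ^ (3 / 2 : ℝ) * (rexp (-(π * n ^ 2) * (1 / u)) * rexp (-(π * y ^ 2) * u))) with hF
  have hF0 : F 0 = 0 := by funext u; simp [F]
  have hint : ∀ n, Integrable (F n) (volume.restrict (Ioi 0)) := by
    intro n
    rcases Nat.eq_zero_or_pos n with rfl | hn
    · rw [hF0]; exact integrable_zero _ _ _
    · exact (integral_term_eq a hy hn).1
  -- the sum of the integrals of the norms
  have hnorm : ∀ n, ∫ u in Ioi (0 : ℝ), ‖F n u‖ ≤ 2 * rexp (-(2 * π * y)) ^ n := by
    intro n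
    rcases Nat.eq_zero_or_pos n with rfl | hn
    · simp [hF0]
    have hn' : (0 : ℝ) < n := by exact_mod_cast hn
    have heq : ∀ u ∈ Ioi (0 : ℝ), ‖F n u‖ = |2 * n * Real.sin (2 * π * a * n)| *
        (1 / u ^ (3 / 2 : ℝ) * (rexp (-(π * n ^ 2) * (1 / u)) * rexp (-(π * y ^ 2) * u))) := by
      intro u hu
      have hu0 : (0 : ℝ) < u := hu
      simp only [F, Real.norm_eq_abs]
      rw [abs_mul, abs_of_nonneg (by positivity : (0 : ℝ) ≤
        1 / u ^ (3 / 2 : ℝ) * (rexp (-(π * n ^ 2) * (1 / u)) * rexp (-(π * y ^ 2) * u)))]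
    rw [setIntegral_congr_fun measurableSet_Ioi heq, integral_const_mul]
    have hα : 0 < π * y ^ 2 := by positivity
    have hβ : 0 < π * (n : ℝ) ^ 2 := by positivity
    obtain ⟨-, hval⟩ :=
      Literature.Analysis.SpecialFunctions.BesselKHalf.integral_one_div_rpow_mul_exp_neg_div_add_mul
        hα hβ
    rw [hval]
    have h1 : Real.sqrt (π / (π * (n : ℝ) ^ 2)) = 1 / n := by
      rw [show π / (π * (n : ℝ) ^ 2) = (1 / n) ^ 2 by field_simp, Real.sqrt_sq (by positivity)]
    have h2 : Real.sqrt (π * y ^ 2 * (π * (n : ℝ) ^ 2)) = π * n * y := by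
      rw [show π * y ^ 2 * (π * (n : ℝ) ^ 2) = (π * n * y) ^ 2 by ring,
        Real.sqrt_sq (by positivity)]
    rw [h1, h2, abs_mul, abs_mul, abs_of_pos (by norm_num : (0 : ℝ) < 2), abs_of_pos hn']
    have hs : |Real.sin (2 * π * a * n)| ≤ 1 := Real.abs_sin_le_one _
    have he : rexp (-(2 * (π * n * y))) = rexp (-(2 * π * y)) ^ n := by
      rw [← Real.exp_nat_mul]; congr 1; ring
    rw [he]
    have hpos : 0 < rexp (-(2 * π * y)) ^ n := by positivity
    calc 2 * ↑n * |Real.sin (2 * π * a * ↑n)| * (1 / ↑n * rexp (-(2 * π * y)) ^ n)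
        = (2 * |Real.sin (2 * π * a * ↑n)|) * rexp (-(2 * π * y)) ^ n := by field_simp
      _ ≤ 2 * rexp (-(2 * π * y)) ^ n := by nlinarith
  have hgeom : Summable fun n : ℕ ↦ 2 * rexp (-(2 * π * y)) ^ n := by
    refine (summable_geometric_of_lt_one (Real.exp_pos _).le ?_).mul_left 2
    rw [Real.exp_lt_one_iff]
    have : 0 < 2 * π * y := by positivity
    linarith
  have hsum : Summable fun n : ℕ ↦ ∫ u in Ioi (0 : ℝ), ‖F n u‖ :=
    Summable.of_nonneg_of_le (fun n ↦ integral_nonneg fun u ↦ norm_nonneg _) hnorm hgeom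
  have hmain := hasSum_integral_of_summable_integral_norm hint hsum
  -- identify the integrals of the terms
  have hterm : ∀ n, ∫ u in Ioi (0 : ℝ), F n u =
      2 * Real.sin (2 * π * a * n) * rexp (-(2 * π * n * y)) := by
    intro n
    rcases Nat.eq_zero_or_pos n with rfl | hn
    · simp [hF0]
    · exact (integral_term_eq a hy hn).2
  simp_rw [hterm] at hmain
  -- identify the sum of the terms with the kernel
  have hpt : ∀ u ∈ Ioi (0 : ℝ), ∑' n, F n u = oddKernel a u * rexp (-(π * y ^ 2) * u) := by
    intro u hu
    have hu0 : (0 : ℝ) < u := hu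
    have hS := (hasSum_nat_sinKernel a (one_div_pos.mpr hu0)).mul_left
      (1 / u ^ (3 / 2 : ℝ) * rexp (-(π * y ^ 2) * u))
    have hS' : HasSum (fun n ↦ F n u) (1 / u ^ (3 / 2 : ℝ) * rexp (-(π * y ^ 2) * u) *
        sinKernel (↑a) (1 / u)) := by
      refine hS.congr_fun fun n ↦ ?_
      simp only [F]
      have : rexp (-π * (n : ℝ) ^ 2 * (1 / u)) = rexp (-(π * n ^ 2) * (1 / u)) := by ring_nf
      rw [this]
      ring
    rw [hS'.tsum_eq, oddKernel_functional_equation]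
    ring
  rwa [setIntegral_congr_fun measurableSet_Ioi hpt] at hmain

/-! ### The real part of the `q`-expansion of `cot` -/

/-- **`Re cot π(a + iy) = Σ_n 2 sin(2πna) e^{−2πny}` for `y > 0`** (real part of
`cot πz = −i(1 + 2Σ_{n≥1} qⁿ)`, `q = e^{2πiz}`; Mathlib's `pi_mul_cot_pi_q_exp`). [folklore] -/
theorem hasSum_re_cot (a : ℝ) {y : ℝ} (hy : 0 < y) :
    HasSum (fun n : ℕ ↦ 2 * Real.sin (2 * π * a * n) * rexp (-(2 * π * n * y)))
      (Complex.cot (π * (a + y * I))).re := by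
  let z : UpperHalfPlane := ⟨a + y * I, by simpa using hy⟩
  have hz : (z : ℂ) = a + y * I := rfl
  set q : ℂ := cexp (2 * π * I * z) with hq
  have hq1 : ‖q‖ < 1 := UpperHalfPlane.norm_exp_two_pi_I_lt_one z
  have hgeom : HasSum (fun n : ℕ ↦ q ^ n) (∑' n : ℕ, q ^ n) :=
    (summable_geometric_of_norm_lt_one hq1).hasSum
  have hcot : Complex.cot (π * (a + y * I)) = I - 2 * I * ∑' n : ℕ, q ^ n := by
    have h := pi_mul_cot_pi_q_exp z
    rw [hz] at h
    have hπ : (π : ℂ) ≠ 0 := ofReal_ne_zero.mpr Real.pi_ne_zero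
    have h' : (π : ℂ) * Complex.cot (π * (a + y * I)) = π * (I - 2 * I * ∑' n : ℕ, q ^ n) := by
      rw [h]; ring
    exact mul_left_cancel₀ hπ h'
  -- real part
  have hterm : ∀ n : ℕ, (q ^ n).im = Real.sin (2 * π * a * n) * rexp (-(2 * π * n * y)) := by
    intro n
    rw [hq, ← Complex.exp_nat_mul, Complex.exp_im, hz]
    simp only [mul_re, mul_im, natCast_re, natCast_im, ofReal_re, ofReal_im, I_re, I_im,
      add_re, add_im, re_ofNat, im_ofNat]
    ring_nf
  have hS : HasSum (fun n : ℕ ↦ 2 * ((q ^ n).im)) (2 * (∑' n : ℕ, q ^ n).im) :=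
    (Complex.hasSum_im hgeom).mul_left 2
  have hre : (Complex.cot (π * (a + y * I))).re = 2 * (∑' n : ℕ, q ^ n).im := by
    rw [hcot]
    simp
  rw [hre]
  refine hS.congr_fun fun n ↦ ?_
  rw [hterm]
  ring

/-- **`∫₀^∞ oddKernel(a, u) e^{−πy²u} du = Re cot π(a + iy)` for `y > 0`.** [folklore] -/
theorem integral_oddKernel_mul_exp_eq_re_cot_of_pos (a : ℝ) {y : ℝ} (hy : 0 < y) :
    ∫ u in Ioi (0 : ℝ), oddKernel a u * rexp (-(π * y ^ 2) * u) =
      (Complex.cot (π * (a + y * I))).re :=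
  (hasSum_integral_oddKernel_mul_exp a hy).unique (hasSum_re_cot a hy)

/-! ### `y → 0⁺`: `∫₀^∞ oddKernel(a, u) du = cot πa` for `a ∉ ℤ` -/

/-- `cot` is continuous at the points `πw`, `w ∉ ℤ`. [folklore] -/
theorem continuousAt_cot {w : ℂ} (hw : w ∈ Complex.integerComplement) :
    ContinuousAt Complex.cot (π * w) := by
  have hsin : Complex.sin (π * w) ≠ 0 := sin_pi_mul_ne_zero hw
  have : Complex.cot = fun z ↦ Complex.cos z / Complex.sin z := by
    funext z; rfl
  rw [this]
  exact Complex.continuous_cos.continuousAt.div Complex.continuous_sin.continuousAt hsin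

/-- **`∫₀^∞ oddKernel(a, u) du = cot πa` for `a ∉ ℤ`** (let `y → 0⁺` in the previous formula:
dominated convergence on the left, continuity of `cot` at `πa` on the right). This is the
Eisenstein sum `Σ_m (m + a)⁻¹ = π cot πa` seen through the Mellin transform, with no appeal to
special values of the Hurwitz zeta function. [folklore] -/
theorem integral_oddKernel_eq_re_cot {a : ℝ} (ha : (a : ℂ) ∈ Complex.integerComplement) :
    ∫ u in Ioi (0 : ℝ), oddKernel a u = (Complex.cot (π * a)).re := by
  -- left: dominated convergence as `y → 0⁺`
  have hL : Tendsto (fun y : ℝ ↦ ∫ u in Ioi (0 : ℝ), oddKernel a u * rexp (-(π * y ^ 2) * u))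
      (𝓝[>] 0) (𝓝 (∫ u in Ioi (0 : ℝ), oddKernel a u)) := by
    have hlim : ∫ u in Ioi (0 : ℝ), oddKernel a u =
        ∫ u in Ioi (0 : ℝ), oddKernel a u * rexp (-(π * 0 ^ 2) * u) := by
      refine setIntegral_congr_fun measurableSet_Ioi fun u _ ↦ ?_
      simp
    rw [hlim]
    refine tendsto_integral_filter_of_dominated_convergence
      (fun u ↦ ‖oddKernel (a : UnitAddCircle) u‖) ?_ ?_ (integrableOn_oddKernel a).norm ?_
    · refine Eventually.of_forall fun y ↦ ?_
      exact ((continuousOn_oddKernel _).mul (by fun_prop)).aestronglyMeasurable measurableSet_Ioi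
    · refine Eventually.of_forall fun y ↦ ?_
      filter_upwards [ae_restrict_mem measurableSet_Ioi] with u hu
      have hu0 : (0 : ℝ) < u := hu
      rw [norm_mul, Real.norm_of_nonneg (Real.exp_pos _).le]
      refine mul_le_of_le_one_right (norm_nonneg _) ?_
      rw [Real.exp_le_one_iff]
      have : 0 ≤ π * y ^ 2 * u := by positivity
      linarith
    · filter_upwards with u
      have hc : Continuous fun y : ℝ ↦ oddKernel (a : UnitAddCircle) u * rexp (-(π * y ^ 2) * u) := by
        fun_prop
      have h0 := hc.tendsto 0
      simp only [ne_eq, OfNat.ofNat_ne_zero, not_false_eq_true, zero_pow, mul_zero, neg_zero,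
        zero_mul, Real.exp_zero, mul_one] at h0
      have h0' : Tendsto (fun y : ℝ ↦ oddKernel (a : UnitAddCircle) u * rexp (-(π * y ^ 2) * u))
          (𝓝 0) (𝓝 (oddKernel (a : UnitAddCircle) u * rexp (-(π * 0 ^ 2) * u))) := by
        simpa using h0
      exact h0'.mono_left nhdsWithin_le_nhds
  -- right: continuity of `cot`
  have hR : Tendsto (fun y : ℝ ↦ (Complex.cot (π * (a + y * I))).re) (𝓝[>] 0)
      (𝓝 (Complex.cot (π * a)).re) := by
    have h1 : Tendsto (fun y : ℝ ↦ (π : ℂ) * (a + y * I)) (𝓝 0) (𝓝 (π * a)) := by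
      have : Continuous fun y : ℝ ↦ (π : ℂ) * (a + y * I) := by fun_prop
      simpa using this.tendsto 0
    have h2 := ((continuousAt_cot ha).tendsto.comp h1)
    exact ((Complex.continuous_re.tendsto _).comp h2).mono_left nhdsWithin_le_nhds
  -- the two agree for `y > 0`
  have hEq : (fun y : ℝ ↦ ∫ u in Ioi (0 : ℝ), oddKernel a u * rexp (-(π * y ^ 2) * u)) =ᶠ[𝓝[>] 0]
      fun y : ℝ ↦ (Complex.cot (π * (a + y * I))).re := by
    filter_upwards [self_mem_nhdsWithin] with y (hy : 0 < y)
    exact integral_oddKernel_mul_exp_eq_re_cot_of_pos a hy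
  exact tendsto_nhds_unique_of_eventuallyEq hL hR hEq

/-! ### All real `y` -/

/-- `Re cot π(a − iy) = Re cot π(a + iy)` (conjugation). [folklore] -/
theorem re_cot_conj (a y : ℝ) :
    (Complex.cot (π * (a + (-y : ℝ) * I))).re = (Complex.cot (π * (a + y * I))).re := by
  have h : (π : ℂ) * (a + ((-y : ℝ) : ℂ) * I) = (starRingEnd ℂ) (π * (a + y * I)) := by
    simp only [map_mul, map_add, Complex.conj_ofReal, Complex.conj_I, ofReal_neg]
    ring
  rw [h, Complex.cot_conj, Complex.conj_re]

/-- **`∫₀^∞ oddKernel(a, u) e^{−πy²u} du = Re cot π(a + iy)`** for every real `y`, provided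
`y ≠ 0` or `a ∉ ℤ` (i.e. `a + iy ∉ ℤ`): for `y ≠ 0` everything converges absolutely after one
theta inversion; for `y = 0` it is the principal value `cot πa`. [folklore] -/
theorem integral_oddKernel_mul_exp_eq_re_cot (a y : ℝ)
    (h : y ≠ 0 ∨ (a : ℂ) ∈ Complex.integerComplement) :
    ∫ u in Ioi (0 : ℝ), oddKernel a u * rexp (-(π * y ^ 2) * u) =
      (Complex.cot (π * (a + y * I))).re := by
  rcases lt_trichotomy y 0 with hy | rfl | hy
  · have hy' : 0 < -y := by linarith
    have h1 := integral_oddKernel_mul_exp_eq_re_cot_of_pos a hy'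
    rw [neg_sq] at h1
    rw [h1, re_cot_conj]
  · have ha : (a : ℂ) ∈ Complex.integerComplement := by
      rcases h with h | h
      · exact absurd rfl h
      · exact h
    simp only [ne_eq, OfNat.ofNat_ne_zero, not_false_eq_true, zero_pow, mul_zero, neg_zero,
      zero_mul, Real.exp_zero, mul_one, ofReal_zero, add_zero]
    exact integral_oddKernel_eq_re_cot ha
  · exact integral_oddKernel_mul_exp_eq_re_cot_of_pos a hy

end GaussianTheta

end Literature.NumberTheory.LFunctions

end
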